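import Literature.NumberTheory.QuadraticForms.QuadraticNormIndex
import Literature.NumberTheory.QuadraticForms.HilbertSymbolLocal
import Literature.NumberTheory.QuadraticForms.HilbertSymbolPrescribed
import HarnessLib

/-!
# O'Meara 71:19 (elements with prescribed Hilbert symbols) from the norm index theorems
# 65:21, 63:13 and Hilbert reciprocity 71:18

Sibling proof file of `Literature.NumberTheory.QuadraticForms.HilbertSymbolPrescribed`
(namespace `Literature`), all declarations fully proved. It reduces the named fact
`exists_hilbertSymbol_eq_neg_one_iff K` (O'Meara Thm. 71:19 with Cor. 71:19a) to the three named
facts that make up O'Meara's own proof (§71, proof of 71:19):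

* `normIdeles_index_dvd_two K` (the *second inequality* `(J_K : P_K N_{E/K} J_E) ∣ 2`, i.e.
  what O'Meara's proof of Prop. 65:21 establishes — its step 1 reduces 65:21,
  `(J_K : P_K N_{E/K} J_E) = 2`, to `≤ 2`; `QuadraticNormIndex.lean`), or the stronger
  `normIdeles_index_eq_two K` (Prop. 65:21 itself),
* `adicCompletion_exists_hilbertSymbol_eq_neg_one K` (Prop. 63:13, a local non-norm exists,
  `QuadraticNormIndex.lean`),
* `hilbertReciprocity K` (Thm. 71:18, `HilbertSymbol.lean`),

by the theorem `exists_hilbertSymbol_eq_neg_one_iff_of_normIdeles_index_dvd_two` (and its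
corollary `exists_hilbertSymbol_eq_neg_one_iff_of_normIdeles_index_eq_two`); the variants
`…_of_dyadic` assume 63:13 only at the dyadic places (`2 ∈ v`), the non-dyadic case being the
proved theorem `adicCompletion_exists_hilbertSymbol_eq_neg_one_of_not_mem`
(`HilbertSymbolLocal.lean`).

## The argument (O'Meara §71, proof of 71:19, made index-theoretic)

Let `a` be a non-square at the places of `S ∪ T` (`S` finite places, `T` real places,
`|S| + |T|` even), `E = K(√a)`, `N_v ⊆ K_vˣ` the local norm groups (`quadraticNormSubgroup`, a
group by Brahmagupta's identity — no local index computation is needed) and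
`H = P_K · N_{E/K} J_E = principalIdeles K ⊔ normIdeles K a`, of index dividing `2` (the second
inequality; if the index is `1` there is nothing to prove, so assume it is `2`). For an idèle
`i = (θ) n ∈ H` the places where `i_v ∉ N_v` are the places where `(θ, a)_v = -1`
(`(θ, a)_v = 1 ↔ θ ∈ N_v`, O'Meara §65A), an even number of them by reciprocity
(`even_card_of_mem_principalIdeles_sup_normIdeles`). Let `j` be the idèle equal to a local
non-norm `t_v` (63:13) at `v ∈ S`, to `-1` at `w ∈ T`, and to `1` elsewhere (`ideleOf`). If
`j ∉ H`, pick a place `P ∈ S ∪ T` and the idèle `i₀` equal to `j_P` at `P` and `1` elsewhere: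
`i₀ ∉ H` (one bad place), so `j i₀ ∈ H` (index `2`), but `j i₀` is a non-norm exactly on
`(S ∪ T) ∖ {P}` (at `P` its component `t_P²` is a norm), an odd set — contradiction. Hence
`j = (θ) n ∈ H` and `θ` has `(θ, a)_v = -1` exactly on `S ∪ T`. (O'Meara phrases the same via the
character `φ(i) = ∏_𝔭 (i_𝔭, a)_𝔭`, whose multiplicativity is the local norm index theorem 63:13a;
the index-`2` bookkeeping above avoids it, and shows that only the inequality
`(J_K : P_K N_{E/K} J_E) ≤ 2` of 65:21 is used — the inequality `≥ 2` (65:14) is replaced by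
reciprocity.)

## References

* O. T. O'Meara, *Introduction to quadratic forms*, Grundlehren 117, Springer (1963), §63B
  (63:13), §65A (Example 65:2), §65D (65:21), §71 (71:18, 71:19, 71:19a and its proof).
* M.-F. Vignéras, *Arithmétique des algèbres de quaternions*, LNM 800 (1980), Ch. III §3,
  Thm. 3.7 and proof of Thm. 3.8.
* J.-P. Serre, *A course in arithmetic*, GTM 7 (1973), Ch. III §2.2 Thm. 4 (the case `K = ℚ`:
  existence of rational numbers with given Hilbert symbols, from Dirichlet's theorem on primes in
  arithmetic progressions instead of the norm index).
-/

noncomputable section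

open NumberField IsDedekindDomain

namespace Literature.NumberTheory.QuadraticForms

variable (K : Type) [Field K] [NumberField K]

/-! ### Idèles with prescribed components -/

/-- The idèle with prescribed components `s w ∈ K_wˣ` at the infinite places and component `1`
at every finite place (`infiniteIdeles` of the unit `(s_w)_w` of `K_∞ = Π_w K_w`). [folklore] -/
def infiniteIdeleOf (s : ∀ w : InfinitePlace K, (w.Completion)ˣ) : GaloisRepresentations.ideleGroup K :=
  GaloisRepresentations.infiniteIdeles K
    ⟨fun w ↦ (s w : w.Completion), fun w ↦ ((s w)⁻¹ : (w.Completion)ˣ),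
      funext fun w ↦ (s w).mul_inv, funext fun w ↦ (s w).inv_mul⟩

/-- `infiniteIdeleOf K s` has component `s w` at the infinite place `w`. [folklore] -/
@[simp]
theorem ideleInfiniteComponent_infiniteIdeleOf (s : ∀ w : InfinitePlace K, (w.Completion)ˣ)
    (w : InfinitePlace K) : ideleInfiniteComponent K w (infiniteIdeleOf K s) = s w :=
  Units.ext rfl

/-- `infiniteIdeleOf K s` has component `1` at every finite place. [folklore] -/
@[simp]
theorem ideleFiniteComponent_infiniteIdeleOf (s : ∀ w : InfinitePlace K, (w.Completion)ˣ)
    (v : HeightOneSpectrum (𝓞 K)) : ideleFiniteComponent K v (infiniteIdeleOf K s) = 1 :=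
  Units.ext rfl

/-- `localUnits v u` has component `u` at `v`. [folklore] -/
@[simp]
theorem ideleFiniteComponent_localUnits_self (v : HeightOneSpectrum (𝓞 K))
    (u : (v.adicCompletion K)ˣ) : ideleFiniteComponent K v (GaloisRepresentations.localUnits v u) = u :=
  Units.ext (GaloisRepresentations.localUnits_snd_apply_self v u)

/-- `localUnits v' u` has component `1` at a finite place `v ≠ v'`. [folklore] -/
theorem ideleFiniteComponent_localUnits_of_ne {v v' : HeightOneSpectrum (𝓞 K)}
    (u : (v'.adicCompletion K)ˣ) (h : v ≠ v') : ideleFiniteComponent K v (GaloisRepresentations.localUnits v' u) = 1 :=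
  Units.ext (GaloisRepresentations.finiteAdeleSingle_apply_of_ne (u : v'.adicCompletion K) h)

/-- `localUnits v u` has component `1` at every infinite place. [folklore] -/
@[simp]
theorem ideleInfiniteComponent_localUnits (v : HeightOneSpectrum (𝓞 K))
    (u : (v.adicCompletion K)ˣ) (w : InfinitePlace K) :
    ideleInfiniteComponent K w (GaloisRepresentations.localUnits v u) = 1 :=
  Units.ext rfl

/-- The idèle with components `t v` at the finite places `v ∈ S`, `1` at the finite places
`v ∉ S`, and `s w` at the infinite places `w`. [folklore] -/
def ideleOf (S : Finset (HeightOneSpectrum (𝓞 K)))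
    (t : ∀ v : HeightOneSpectrum (𝓞 K), (v.adicCompletion K)ˣ)
    (s : ∀ w : InfinitePlace K, (w.Completion)ˣ) : GaloisRepresentations.ideleGroup K :=
  (∏ v ∈ S, GaloisRepresentations.localUnits v (t v)) * infiniteIdeleOf K s

/-- Finite components of `ideleOf K S t s` at `v ∈ S`. [folklore] -/
theorem ideleFiniteComponent_ideleOf_of_mem {S : Finset (HeightOneSpectrum (𝓞 K))}
    (t : ∀ v : HeightOneSpectrum (𝓞 K), (v.adicCompletion K)ˣ)
    (s : ∀ w : InfinitePlace K, (w.Completion)ˣ) {v : HeightOneSpectrum (𝓞 K)} (hv : v ∈ S) :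
    ideleFiniteComponent K v (ideleOf K S t s) = t v := by
  simp only [ideleOf, map_mul, map_prod, ideleFiniteComponent_infiniteIdeleOf, mul_one]
  rw [Finset.prod_eq_single_of_mem v hv fun v' _ hne ↦
    ideleFiniteComponent_localUnits_of_ne K (t v') hne.symm]
  exact ideleFiniteComponent_localUnits_self K v (t v)

/-- Finite components of `ideleOf K S t s` at `v ∉ S`. [folklore] -/
theorem ideleFiniteComponent_ideleOf_of_not_mem {S : Finset (HeightOneSpectrum (𝓞 K))}
    (t : ∀ v : HeightOneSpectrum (𝓞 K), (v.adicCompletion K)ˣ)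
    (s : ∀ w : InfinitePlace K, (w.Completion)ˣ) {v : HeightOneSpectrum (𝓞 K)} (hv : v ∉ S) :
    ideleFiniteComponent K v (ideleOf K S t s) = 1 := by
  simp only [ideleOf, map_mul, map_prod, ideleFiniteComponent_infiniteIdeleOf, mul_one]
  exact Finset.prod_eq_one fun v' hv' ↦
    ideleFiniteComponent_localUnits_of_ne K (t v') fun h ↦ hv (h ▸ hv')

/-- Infinite components of `ideleOf K S t s`. [folklore] -/
@[simp]
theorem ideleInfiniteComponent_ideleOf (S : Finset (HeightOneSpectrum (𝓞 K)))
    (t : ∀ v : HeightOneSpectrum (𝓞 K), (v.adicCompletion K)ˣ)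
    (s : ∀ w : InfinitePlace K, (w.Completion)ˣ) (w : InfinitePlace K) :
    ideleInfiniteComponent K w (ideleOf K S t s) = s w := by
  simp only [ideleOf, map_mul, map_prod, ideleInfiniteComponent_localUnits,
    Finset.prod_const_one, one_mul, ideleInfiniteComponent_infiniteIdeleOf]

/-! ### Local facts at the real places -/

variable {K} in
omit [NumberField K] in
/-- At a real place `w` where `a` is not a square (i.e. `a < 0` in `K_w ≅ ℝ`), `-1` is not a norm
from `K_w(√a) ≅ ℂ`: `x² - a y² ≥ 0`. (The real case of O'Meara 63:13: `(-1, a)_w = -1`.)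
[folklore] -/
theorem neg_one_not_mem_quadraticNormSubgroup_of_isReal {w : InfinitePlace K} (hw : w.IsReal)
    {a : w.Completion} (ha : ¬ IsSquare a) :
    (-1 : (w.Completion)ˣ) ∉ quadraticNormSubgroup w.Completion a := by
  rintro ⟨x, y, hxy⟩
  set ψ := InfinitePlace.Completion.ringEquivRealOfIsReal hw
  have ha' : ψ a < 0 := by
    refine lt_of_not_ge fun h ↦ ha ⟨ψ.symm (Real.sqrt (ψ a)), ψ.injective ?_⟩
    rw [map_mul, RingEquiv.apply_symm_apply, Real.mul_self_sqrt h]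
  have h := congr_arg ψ hxy
  rw [Units.val_neg, Units.val_one, map_neg, map_one, map_sub, map_pow, map_mul, map_pow] at h
  nlinarith [sq_nonneg (ψ x), mul_nonneg (neg_nonneg.2 ha'.le) (sq_nonneg (ψ y))]

/-! ### Parity of the non-norm places of an idèle in `P_K · N_{E/K} J_E` -/

variable {K} in
/-- **Reciprocity for `H = P_K · N_{E/K} J_E`.** Let `a ≠ 0` and let `i = (θ) n` be a principal
idèle times a norm idèle of `K(√a)/K`. If the finite places where `i_v` is not a local norm are
exactly those of `S`, and the infinite ones exactly those of `T`, then `|S| + |T|` is even: these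
are the places where `(θ, a) = -1` (O'Meara §65A), to which Hilbert reciprocity (71:18,
`hilbertReciprocity`) applies. [cite: Omeara1963, §71 proof of Thm. 71:19] -/
theorem even_card_of_mem_principalIdeles_sup_normIdeles {a : K} (ha : a ≠ 0)
    (hrec : ∀ θ : K, hilbertReciprocity K θ a) {i : GaloisRepresentations.ideleGroup K}
    (hi : i ∈ GaloisRepresentations.principalIdeles K ⊔ normIdeles K a)
    (S : Finset (HeightOneSpectrum (𝓞 K))) (T : Finset (InfinitePlace K))
    (hS : ∀ v : HeightOneSpectrum (𝓞 K), ideleFiniteComponent K v i ∉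
        quadraticNormSubgroup (v.adicCompletion K) (algebraMap K _ a) ↔ v ∈ S)
    (hT : ∀ w : InfinitePlace K, ideleInfiniteComponent K w i ∉
        quadraticNormSubgroup w.Completion (algebraMap K _ a) ↔ w ∈ T) :
    Even (S.card + T.card) := by
  obtain ⟨p, hp, n, hn, rfl⟩ := Subgroup.mem_sup.1 hi
  obtain ⟨θ, rfl⟩ := MonoidHom.mem_range.1 hp
  rw [mem_normIdeles_iff] at hn
  obtain ⟨-, heven⟩ := hrec θ θ.ne_zero ha
  have eS : {v : HeightOneSpectrum (𝓞 K) |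
      hilbertSymbol (v.adicCompletion K) (algebraMap K _ (θ : K)) (algebraMap K _ a) = -1} =
        ↑S := by
    ext v
    haveI : CharZero (v.adicCompletion K) :=
      charZero_of_injective_algebraMap (algebraMap K _).injective
    rw [Finset.mem_coe, ← hS v, Set.mem_setOf_eq, map_mul, Subgroup.mul_mem_cancel_right _ (hn.1 v),
      ideleFiniteComponent_principal,
      ← hilbertSymbol_eq_neg_one_iff_not_mem_quadraticNormSubgroup ((map_ne_zero _).2 ha)]
    rfl
  have eT : {w : InfinitePlace K |
      hilbertSymbol w.Completion (algebraMap K _ (θ : K)) (algebraMap K _ a) = -1} = ↑T := by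
    ext w
    haveI : CharZero w.Completion := charZero_of_injective_algebraMap (algebraMap K _).injective
    rw [Finset.mem_coe, ← hT w, Set.mem_setOf_eq, map_mul, Subgroup.mul_mem_cancel_right _ (hn.2 w),
      ideleInfiniteComponent_principal,
      ← hilbertSymbol_eq_neg_one_iff_not_mem_quadraticNormSubgroup ((map_ne_zero _).2 ha)]
    rfl
  rwa [eS, eT, Set.ncard_coe_finset, Set.ncard_coe_finset] at heven

/-! ### O'Meara 71:19 from 65:21, 63:13 and 71:18 -/

/-- **O'Meara 71:19 / 71:19a from the second inequality, 63:13 and reciprocity** (O'Meara's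
proof, §71, proof of 71:19, with 65:21 weakened to the second inequality): the named facts
`normIdeles_index_dvd_two K` (`(J_K : P_K N_{E/K} J_E) ∣ 2`, proof of 65:21),
`adicCompletion_exists_hilbertSymbol_eq_neg_one K` (63:13) and `hilbertReciprocity K` (71:18)
imply `exists_hilbertSymbol_eq_neg_one_iff K` — for finite places `S`, real places `T` with
`|S| + |T|` even and `a` a local non-square on `S ∪ T` there is `θ ∈ Kˣ` with `(θ, a)_v = -1`
exactly for `v ∈ S` and `(θ, a)_w = -1` exactly for `w ∈ T`. See the module docstring for the
argument. [cite: Omeara1963, §71 Thm. 71:19 and Cor. 71:19a (proof)] -/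
theorem exists_hilbertSymbol_eq_neg_one_iff_of_normIdeles_index_dvd_two
    (h65 : normIdeles_index_dvd_two K) (h63 : adicCompletion_exists_hilbertSymbol_eq_neg_one K)
    (h71 : ∀ a b : K, hilbertReciprocity K a b) : exists_hilbertSymbol_eq_neg_one_iff K := by
  intro a S T hT hST haS haT
  classical
  -- the trivial case `S = T = ∅`: `θ = 1`
  by_cases h0 : S = ∅ ∧ T = ∅
  · obtain ⟨rfl, rfl⟩ := h0
    refine ⟨1, one_ne_zero, fun v ↦ ?_, fun w ↦ ?_⟩
    · rw [map_one, hilbertSymbol_one_left]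
      simp
    · rw [map_one, hilbertSymbol_one_left]
      simp
  -- `a` is a non-square in `K` (and non-zero)
  have hasq : ¬ IsSquare a := by
    intro hsq
    rcases not_and_or.1 h0 with hS0 | hT0
    · obtain ⟨v, hv⟩ := Finset.nonempty_iff_ne_empty.2 hS0
      exact haS v hv (hsq.map (algebraMap K _))
    · obtain ⟨w, hw⟩ := Finset.nonempty_iff_ne_empty.2 hT0
      exact haT w hw (hsq.map (algebraMap K _))
  have ha0 : a ≠ 0 := by
    rintro rfl
    exact hasq IsSquare.zero
  have hrec : ∀ θ : K, hilbertReciprocity K θ a := fun θ ↦ h71 θ a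
  -- notation for the local norm groups
  set N : ∀ v : HeightOneSpectrum (𝓞 K), Subgroup (v.adicCompletion K)ˣ :=
    fun v ↦ quadraticNormSubgroup (v.adicCompletion K) (algebraMap K _ a) with hN
  set N' : ∀ w : InfinitePlace K, Subgroup (w.Completion)ˣ :=
    fun w ↦ quadraticNormSubgroup w.Completion (algebraMap K _ a) with hN'
  -- local non-norms `t v` at `v ∈ S` (63:13) and `-1` at `w ∈ T`
  have hloc : ∀ v ∈ S, ∃ t : (v.adicCompletion K)ˣ, t ∉ N v := by
    intro v hv
    haveI : CharZero (v.adicCompletion K) :=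
      charZero_of_injective_algebraMap (algebraMap K _).injective
    obtain ⟨α, hα0, hα⟩ := h63 v (algebraMap K _ a) ((map_ne_zero _).2 ha0) (haS v hv)
    exact ⟨Units.mk0 α hα0, (hilbertSymbol_eq_neg_one_iff_not_mem_quadraticNormSubgroup
      ((map_ne_zero _).2 ha0) (Units.mk0 α hα0)).1 hα⟩
  let t : ∀ v : HeightOneSpectrum (𝓞 K), (v.adicCompletion K)ˣ := fun v ↦
    if hv : v ∈ S then (hloc v hv).choose else 1
  have ht : ∀ v ∈ S, t v ∉ N v := fun v hv ↦ by
    simp only [t, dif_pos hv]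
    exact (hloc v hv).choose_spec
  have hinf : ∀ w ∈ T, (-1 : (w.Completion)ˣ) ∉ N' w := fun w hw ↦
    neg_one_not_mem_quadraticNormSubgroup_of_isReal (hT w hw) (haT w hw)
  let s : ∀ w : InfinitePlace K, (w.Completion)ˣ := fun w ↦ if w ∈ T then -1 else 1
  -- the idèle `j`, a local non-norm exactly on `S ∪ T`
  set j : GaloisRepresentations.ideleGroup K := ideleOf K S t s with hj
  have hjS : ∀ v, ideleFiniteComponent K v j ∉ N v ↔ v ∈ S := by
    intro v
    by_cases hv : v ∈ S
    · rw [hj, ideleFiniteComponent_ideleOf_of_mem K t s hv]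
      simp only [hv, iff_true]
      exact ht v hv
    · rw [hj, ideleFiniteComponent_ideleOf_of_not_mem K t s hv]
      simp only [hv, iff_false, not_not]
      exact one_mem _
  have hjT : ∀ w, ideleInfiniteComponent K w j ∉ N' w ↔ w ∈ T := by
    intro w
    rw [hj, ideleInfiniteComponent_ideleOf]
    by_cases hw : w ∈ T
    · simp only [s, hw, if_true, iff_true]
      exact hinf w hw
    · simp only [s, hw, if_false, iff_false, not_not]
      exact one_mem _
  -- `H = P_K · N_{E/K} J_E` has index `1` or `2` (second inequality)
  set H : Subgroup (GaloisRepresentations.ideleGroup K) := GaloisRepresentations.principalIdeles K ⊔ normIdeles K a with hH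
  -- `j ∈ H`
  have hjH : j ∈ H := by
    rcases index_eq_one_or_eq_two_of_normIdeles_index_dvd_two h65 hasq with hH1 | hH2
    · rw [Subgroup.index_eq_one] at hH1
      rw [hH, hH1]
      exact Subgroup.mem_top j
    by_contra hjH
    rcases not_and_or.1 h0 with hS0 | hT0
    · -- a finite bad place `v₀ ∈ S`
      obtain ⟨v₀, hv₀⟩ := Finset.nonempty_iff_ne_empty.2 hS0
      have hi₀ : GaloisRepresentations.localUnits v₀ (t v₀) ∉ H := by
        intro hi₀
        have h1 := even_card_of_mem_principalIdeles_sup_normIdeles ha0 hrec hi₀ {v₀} ∅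
          (fun v ↦ ?_) (fun w ↦ ?_)
        · simp at h1
        · by_cases hv : v = v₀
          · subst hv
            simp only [ideleFiniteComponent_localUnits_self, Finset.mem_singleton, iff_true]
            exact ht v hv₀
          · rw [ideleFiniteComponent_localUnits_of_ne K (t v₀) hv]
            simp only [Finset.mem_singleton, hv, iff_false, not_not]
            exact one_mem _
        · simp only [ideleInfiniteComponent_localUnits, Finset.notMem_empty, iff_false, not_not]
          exact one_mem _
      have hji₀ : j * GaloisRepresentations.localUnits v₀ (t v₀) ∈ H :=
        (Subgroup.mul_mem_iff_of_index_two hH2).2 (iff_of_false hjH hi₀)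
      have h2 := even_card_of_mem_principalIdeles_sup_normIdeles ha0 hrec hji₀ (S.erase v₀) T
        (fun v ↦ ?_) (fun w ↦ ?_)
      · rw [Finset.card_erase_of_mem hv₀] at h2
        have h3 : 1 ≤ S.card := Finset.card_pos.2 ⟨v₀, hv₀⟩
        obtain ⟨m, hm⟩ := hST
        obtain ⟨m', hm'⟩ := h2
        omega
      · rw [map_mul]
        by_cases hv : v = v₀
        · subst hv
          simp only [ideleFiniteComponent_localUnits_self, Finset.mem_erase, ne_eq,
            not_true_eq_false, false_and, iff_false, not_not]
          have hsq := mul_self_mem_quadraticNormSubgroup (algebraMap K (v.adicCompletion K) a) (t v)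
          have hjv : ideleFiniteComponent K v j = t v := by
            rw [hj, ideleFiniteComponent_ideleOf_of_mem K t s hv₀]
          rw [hjv]
          exact hsq
        · rw [ideleFiniteComponent_localUnits_of_ne K (t v₀) hv, mul_one, hjS v]
          simp [Finset.mem_erase, hv]
      · rw [map_mul, ideleInfiniteComponent_localUnits, mul_one]
        exact hjT w
    · -- an infinite bad place `w₀ ∈ T`
      obtain ⟨w₀, hw₀⟩ := Finset.nonempty_iff_ne_empty.2 hT0
      let s₀ : ∀ w : InfinitePlace K, (w.Completion)ˣ := fun w ↦ if w = w₀ then -1 else 1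
      have hi₀ : infiniteIdeleOf K s₀ ∉ H := by
        intro hi₀
        have h1 := even_card_of_mem_principalIdeles_sup_normIdeles ha0 hrec hi₀ ∅ {w₀}
          (fun v ↦ ?_) (fun w ↦ ?_)
        · simp at h1
        · simp only [ideleFiniteComponent_infiniteIdeleOf, Finset.notMem_empty, iff_false, not_not]
          exact one_mem _
        · rw [ideleInfiniteComponent_infiniteIdeleOf]
          by_cases hw : w = w₀
          · subst hw
            simp only [s₀, if_true, Finset.mem_singleton, iff_true]
            exact hinf w hw₀
          · simp only [s₀, hw, if_false, Finset.mem_singleton, iff_false, not_not]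
            exact one_mem _
      have hji₀ : j * infiniteIdeleOf K s₀ ∈ H :=
        (Subgroup.mul_mem_iff_of_index_two hH2).2 (iff_of_false hjH hi₀)
      have h2 := even_card_of_mem_principalIdeles_sup_normIdeles ha0 hrec hji₀ S (T.erase w₀)
        (fun v ↦ ?_) (fun w ↦ ?_)
      · rw [Finset.card_erase_of_mem hw₀] at h2
        have h3 : 1 ≤ T.card := Finset.card_pos.2 ⟨w₀, hw₀⟩
        obtain ⟨m, hm⟩ := hST
        obtain ⟨m', hm'⟩ := h2
        omega
      · rw [map_mul, ideleFiniteComponent_infiniteIdeleOf, mul_one]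
        exact hjS v
      · rw [map_mul, ideleInfiniteComponent_infiniteIdeleOf]
        by_cases hw : w = w₀
        · subst hw
          simp only [s₀, if_true, Finset.mem_erase, ne_eq, not_true_eq_false, false_and,
            iff_false, not_not]
          have hjw : ideleInfiniteComponent K w j = -1 := by
            rw [hj, ideleInfiniteComponent_ideleOf]
            simp only [s, hw₀, if_true]
          rw [hjw]
          exact mul_self_mem_quadraticNormSubgroup (algebraMap K w.Completion a) (-1)
        · simp only [s₀, hw, if_false, mul_one]
          rw [hjT w]
          simp [Finset.mem_erase, hw]
  -- read off `θ` from `j = (θ) n`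
  obtain ⟨p, hp, n, hn, hpn⟩ := Subgroup.mem_sup.1 hjH
  obtain ⟨θ, rfl⟩ := MonoidHom.mem_range.1 hp
  rw [mem_normIdeles_iff] at hn
  refine ⟨θ, θ.ne_zero, fun v ↦ ?_, fun w ↦ ?_⟩
  · haveI : CharZero (v.adicCompletion K) :=
      charZero_of_injective_algebraMap (algebraMap K _).injective
    rw [← hjS v, ← hpn, map_mul, Subgroup.mul_mem_cancel_right _ (hn.1 v),
      ideleFiniteComponent_principal,
      ← hilbertSymbol_eq_neg_one_iff_not_mem_quadraticNormSubgroup ((map_ne_zero _).2 ha0)]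
    rfl
  · haveI : CharZero w.Completion := charZero_of_injective_algebraMap (algebraMap K _).injective
    rw [← hjT w, ← hpn, map_mul, Subgroup.mul_mem_cancel_right _ (hn.2 w),
      ideleInfiniteComponent_principal,
      ← hilbertSymbol_eq_neg_one_iff_not_mem_quadraticNormSubgroup ((map_ne_zero _).2 ha0)]
    rfl

/-- **O'Meara 71:19 / 71:19a from the norm index theorems and reciprocity** (O'Meara's proof,
§71, proof of 71:19): the named facts `normIdeles_index_eq_two K` (65:21),
`adicCompletion_exists_hilbertSymbol_eq_neg_one K` (63:13) and `hilbertReciprocity K` (71:18)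
imply `exists_hilbertSymbol_eq_neg_one_iff K`. Corollary of
`exists_hilbertSymbol_eq_neg_one_iff_of_normIdeles_index_dvd_two` (index `2` divides `2`).
[cite: Omeara1963, §71 Thm. 71:19 and Cor. 71:19a (proof)] -/
theorem exists_hilbertSymbol_eq_neg_one_iff_of_normIdeles_index_eq_two
    (h65 : normIdeles_index_eq_two K) (h63 : adicCompletion_exists_hilbertSymbol_eq_neg_one K)
    (h71 : ∀ a b : K, hilbertReciprocity K a b) : exists_hilbertSymbol_eq_neg_one_iff K :=
  exists_hilbertSymbol_eq_neg_one_iff_of_normIdeles_index_dvd_two K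
    (normIdeles_index_dvd_two_of_eq_two h65) h63 h71

/-- **Variant: only the dyadic places need O'Meara 63:13 as an input.** Same conclusion as
`exists_hilbertSymbol_eq_neg_one_iff_of_normIdeles_index_dvd_two`, assuming the local fact 63:13
only at the places `v` above `2`; at the other places it is the proved theorem
`adicCompletion_exists_hilbertSymbol_eq_neg_one_of_not_mem` (`HilbertSymbolLocal.lean`).
[cite: Omeara1963, §71 Thm. 71:19 and Cor. 71:19a (proof)] -/
theorem exists_hilbertSymbol_eq_neg_one_iff_of_normIdeles_index_dvd_two_of_dyadic
    (h65 : normIdeles_index_dvd_two K)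
    (h63 : ∀ v : HeightOneSpectrum (𝓞 K), (2 : 𝓞 K) ∈ v.asIdeal →
      ∀ β : v.adicCompletion K, β ≠ 0 → ¬ IsSquare β →
        ∃ α : v.adicCompletion K, α ≠ 0 ∧ hilbertSymbol (v.adicCompletion K) α β = -1)
    (h71 : ∀ a b : K, hilbertReciprocity K a b) : exists_hilbertSymbol_eq_neg_one_iff K :=
  exists_hilbertSymbol_eq_neg_one_iff_of_normIdeles_index_dvd_two K h65
    (fun v β hβ0 hβ ↦ by
      by_cases h2 : (2 : 𝓞 K) ∈ v.asIdeal
      · exact h63 v h2 β hβ0 hβ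
      · exact adicCompletion_exists_hilbertSymbol_eq_neg_one_of_not_mem K v h2 β hβ0 hβ)
    h71

/-- **Variant: only the dyadic places need O'Meara 63:13 as an input.** Same conclusion as
`exists_hilbertSymbol_eq_neg_one_iff_of_normIdeles_index_eq_two`, assuming the local fact 63:13
only at the places `v` above `2`; at the other places it is the proved theorem
`adicCompletion_exists_hilbertSymbol_eq_neg_one_of_not_mem` (`HilbertSymbolLocal.lean`).
[cite: Omeara1963, §71 Thm. 71:19 and Cor. 71:19a (proof)] -/
theorem exists_hilbertSymbol_eq_neg_one_iff_of_normIdeles_index_eq_two_of_dyadic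
    (h65 : normIdeles_index_eq_two K)
    (h63 : ∀ v : HeightOneSpectrum (𝓞 K), (2 : 𝓞 K) ∈ v.asIdeal →
      ∀ β : v.adicCompletion K, β ≠ 0 → ¬ IsSquare β →
        ∃ α : v.adicCompletion K, α ≠ 0 ∧ hilbertSymbol (v.adicCompletion K) α β = -1)
    (h71 : ∀ a b : K, hilbertReciprocity K a b) : exists_hilbertSymbol_eq_neg_one_iff K :=
  exists_hilbertSymbol_eq_neg_one_iff_of_normIdeles_index_dvd_two_of_dyadic K
    (normIdeles_index_dvd_two_of_eq_two h65) h63 h71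

end Literature.NumberTheory.QuadraticForms
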